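import Mathlib.RingTheory.GradedAlgebra.Homogeneous.Ideal
import Mathlib.RingTheory.LocalRing.MaximalIdeal.Basic
import Mathlib.RingTheory.Ideal.Colon
import HarnessLib

/-!
# Crux `FrobeniusLadder.FRationalResolution` (stmt-ResolutionOfSingularities-15317), line `redirect`,
# stub `stub_diagonalizableQuotientResolution` — GRADED TOOLKIT for (α′): colons of homogeneous ideals, homogeneous generators of
# principal homogeneous ideals over LOCAL rings, and the degree test `d·s ∈ 𝒜 0 ⟺ s ∈ 𝒜 (−deg d)`

Second (graded) half of the classification of divisorial ideals of `R = κ'[[P]] = 𝒜 0 ⊆ A = κ'[[x,y,z]]` (the `hfin` slot of the (S1) recipe,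
p840173/p840143; first half `…DivisorialGcd`, p840243). For a commutative ring `A` graded by `𝒜 : ι → σ`:

* `isHomogeneous_colon` — **the colon `(N : P)` of homogeneous ideals is homogeneous** (`ι` a commutative group);
* ★ `exists_homogeneous_generator` — **over a LOCAL domain a principal homogeneous ideal has a HOMOGENEOUS generator**: the components
  `f_i = c_i f` of a generator `f` satisfy `Σ c_i = 1`, so some `c_i` is a unit (no hypothesis on the grading group — torsion allowed, e.g.
  `ℤ/r`; this fails without locality: `(x² − 1) ⊆ ℂ[x]` with the `ℤ/2`-grading);
* `mul_mem_grade_zero_iff` — in a graded domain, for `0 ≠ d ∈ 𝒜 w`: `d·s ∈ 𝒜 0 ⟺ s ∈ 𝒜 (−w)`; hence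
  `mem_comap_mulLeft_range_iff` — the `𝒜 0`-module `M_d = {s : d·s ∈ 𝒜 0}` of `…DivisorialGcd` IS `𝒜 (−w)`.

Honest label: general graded commutative algebra toward ONE leaf stub (no stub, crux or summit closed). No definitions, no named facts, no sorry.
[folklore; cite: BrunsHerzog1993, §1.5] [cite: StacksProject, Tag 00JM]
-/

-- single-problem summit: the doubled namespace component is forced
set_option linter.dupNamespace false

open DirectSum SetLike

namespace Summit.ResolutionOfSingularities.ResolutionOfSingularities.Theorems.FRationalResolution.GradedLocalPrincipal

variable {ι σ A : Type*} [CommRing A] [SetLike σ A] [AddSubmonoidClass σ A] (𝒜 : ι → σ) [DecidableEq ι]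

/-! ## §1 Colons of homogeneous ideals -/

/-- **`(N : P)` is homogeneous for homogeneous `N`, `P`.** [folklore; cite: BrunsHerzog1993, §1.5] -/
theorem isHomogeneous_colon [AddCommGroup ι] [GradedRing 𝒜] {N P : Ideal A} (hN : N.IsHomogeneous 𝒜)
    (hP : P.IsHomogeneous 𝒜) : (N.colon P).IsHomogeneous 𝒜 := by
  classical
  intro i r hr
  rw [Submodule.mem_colon] at hr ⊢
  intro p hp
  rw [← sum_support_decompose 𝒜 p, smul_eq_mul, Finset.mul_sum]
  refine Ideal.sum_mem _ fun j _ => ?_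
  have hpj : (decompose 𝒜 p j : A) ∈ P := hP j hp
  have h1 : r * (decompose 𝒜 p j : A) ∈ N := by
    have := hr _ hpj
    rwa [smul_eq_mul] at this
  have h2 := hN (i + j) h1
  rwa [coe_decompose_mul_add_of_right_mem 𝒜 (coe_mem _)] at h2

/-- `(a)` is homogeneous for homogeneous `a`. [folklore] -/
theorem isHomogeneous_span_singleton [AddMonoid ι] [GradedRing 𝒜] {a : A} {i : ι} (ha : a ∈ 𝒜 i) :
    (Ideal.span ({a} : Set A)).IsHomogeneous 𝒜 :=
  Ideal.homogeneous_span 𝒜 {a} fun x hx => by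
    rw [Set.mem_singleton_iff] at hx
    subst hx
    exact ⟨i, ha⟩

/-! ## §2 Principal homogeneous ideals over local rings -/

/-- ★ **Over a local domain, a principal homogeneous ideal has a homogeneous generator.** If `H = (f)` is homogeneous, `f ≠ 0`, write
`f_i = c_i f` for the homogeneous components; then `(Σ c_i) f = f`, so `Σ c_i = 1` and some `c_i` is a unit: `H = (f_i)`.
[folklore; cite: BrunsHerzog1993, §1.5] -/
theorem exists_homogeneous_generator [AddMonoid ι] [GradedRing 𝒜] [IsDomain A] [IsLocalRing A] {H : Ideal A}
    (hH : H.IsHomogeneous 𝒜) {f : A} (hf : H = Ideal.span {f}) (hf0 : f ≠ 0) :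
    ∃ i : ι, ∃ g : A, g ∈ 𝒜 i ∧ H = Ideal.span {g} := by
  classical
  have hfH : f ∈ H := hf ▸ Ideal.mem_span_singleton_self f
  have hcomp : ∀ i, ∃ c : A, c * f = (decompose 𝒜 f i : A) := fun i =>
    Ideal.mem_span_singleton'.mp (by rw [← hf]; exact hH i hfH)
  choose c hc using hcomp
  have hsum : (∑ i ∈ (decompose 𝒜 f).support, c i) * f = 1 * f := by
    rw [Finset.sum_mul, one_mul]
    simp_rw [hc]
    exact sum_support_decompose 𝒜 f
  have hone : ∑ i ∈ (decompose 𝒜 f).support, c i = 1 := mul_right_cancel₀ hf0 hsum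
  have hex : ∃ i ∈ (decompose 𝒜 f).support, IsUnit (c i) := by
    by_contra h
    have hall : ∀ i ∈ (decompose 𝒜 f).support, c i ∈ IsLocalRing.maximalIdeal A := fun i hi =>
      (IsLocalRing.mem_maximalIdeal _).mpr (mem_nonunits_iff.mpr fun hu => h ⟨i, hi, hu⟩)
    have h1 : (1 : A) ∈ IsLocalRing.maximalIdeal A := hone ▸ Ideal.sum_mem _ hall
    exact (IsLocalRing.maximalIdeal.isMaximal A).ne_top (Ideal.eq_top_of_isUnit_mem _ h1 isUnit_one)
  obtain ⟨i, -, hu⟩ := hex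
  refine ⟨i, decompose 𝒜 f i, coe_mem _, ?_⟩
  rw [hf, ← hc i, Ideal.span_singleton_mul_left_unit hu]

/-! ## §3 The degree test -/

/-- **`d·s ∈ 𝒜 0 ⟺ s ∈ 𝒜 (−w)`** for `0 ≠ d ∈ 𝒜 w` in a graded domain. [folklore] -/
theorem mul_mem_grade_zero_iff [AddCommGroup ι] [GradedRing 𝒜] [IsDomain A] {d : A} {w : ι} (hd : d ∈ 𝒜 w)
    (hd0 : d ≠ 0) (s : A) : d * s ∈ 𝒜 0 ↔ s ∈ 𝒜 (-w) := by
  classical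
  constructor
  · intro h
    have hzero : ∀ j, j ≠ -w → (decompose 𝒜 s j : A) = 0 := by
      intro j hj
      have h1 : (decompose 𝒜 (d * s) (w + j) : A) = d * decompose 𝒜 s j := coe_decompose_mul_add_of_left_mem 𝒜 hd
      have h2 : (decompose 𝒜 (d * s) (w + j) : A) = 0 :=
        decompose_of_mem_ne 𝒜 h fun h0 => hj (by rw [← sub_eq_zero, sub_neg_eq_add, add_comm, ← h0])
      exact (mul_eq_zero.mp (h1.symm.trans h2)).resolve_left hd0
    rw [← sum_support_decompose 𝒜 s]
    refine sum_mem fun j _ => ?_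
    by_cases hj : j = -w
    · subst hj
      exact coe_mem _
    · rw [hzero j hj]
      exact zero_mem _
  · intro hs
    have h := GradedMul.mul_mem hd hs
    rwa [add_neg_cancel] at h

/-- **`M_d = 𝒜 (−w)`**: for `0 ≠ d ∈ 𝒜 w` in a graded domain, an element `s` satisfies `d·s ∈ image (𝒜 0 → A)` iff `s ∈ 𝒜 (−w)` — the
`𝒜 0`-module `{s : d s ∈ 𝒜 0}` onto which `…DivisorialGcd.nonempty_linearEquiv_of_divisorial` maps a divisorial ideal is the graded piece
`𝒜 (−w)`. [folklore] -/
theorem mem_setOf_mul_mem_iff [AddCommGroup ι] [GradedRing 𝒜] [IsDomain A] {d : A} {w : ι} (hd : d ∈ 𝒜 w) (hd0 : d ≠ 0)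
    (s : A) : (∃ r : A, r ∈ 𝒜 0 ∧ r = d * s) ↔ s ∈ 𝒜 (-w) := by
  rw [← mul_mem_grade_zero_iff 𝒜 hd hd0 s]
  constructor
  · rintro ⟨r, hr, rfl⟩
    exact hr
  · exact fun h => ⟨d * s, h, rfl⟩

end Summit.ResolutionOfSingularities.ResolutionOfSingularities.Theorems.FRationalResolution.GradedLocalPrincipal
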